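import Literature.AlgebraicGeometry.Hu2025.Statements.S05ThetaBlowups.R106cThetaBlowups
import Literature.AlgebraicGeometry.Hu2025.Proofs.S05ThetaBlowups.Charts
/-!
# Hu 2025 §5.2 Prop. 5.11 — KERNEL DISCHARGE on the typed carrier (row 106c): the chart-variable bookkeeping of the ϑ-blow-ups

M-HU PREP by res-type-023 (gen 8), 2026-08-27 — FILED by res-type-055 (gen 9) as PARTITION-HU §3b HELPER for the row-106 owner res-type-023 (author of record; res-plan-2 IDLE POOL DEAL #4b 2026-08-27T08:54:38Z; helper TAKING 08:56:19Z, no objection) from the owner's deposited copy of record HOME/plan/tools/res-type-023/hu/file/Prop511.lean sha16 dca6827bed52f14a, UNCHANGED except this filing note; S files R106aCharts = p513406 · R106bThetaFrame = p516097 · R106cThetaBlowups = p518536; Proofs/Charts = p514775 (target `Literature/AlgebraicGeometry/Hu2025/Proofs/S05ThetaBlowups/Prop511.lean`,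
kind proof, after rows 106a–c land). Theorems about OUR carriers (`ChartSeq.strictTransform` along the word `Φ.seq c 0 k` on the fixed
index type `𝕀⋆ ⊔ Λ⋆`); nothing of [Hu25] is asserted. AI work, weaker than expert review.

Proved here, for EVERY frame `Φ`, ring `R`, word `c`, level `k`:
* single step / word: the strict transform of a coordinate hyperplane `(x_y)` is `(x_y)` unless some step of the word has `y` as its
  exceptional index, in which case it is the unit ideal (`ChartSeq.strictTransform_span_X_of_forall_ne / _of_exists_eq`);
* Prop. 5.11 bullets (1) (2) (4) (5) (8) AS TYPED, unconditionally (`prop5_11_b1/b2/b4/b5/b8`);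
* bullets (6) (7) and the «unique label» clause (iii) under the standing facts `Function.Injective Φ.ult` (u_k distinct, C36L120) and
  `lead k = some r → blk r = k` ((4.1) C21L24–L30) — conjuncts (i)/(iv) of `ThetaFrame.IsStandard`; hence `Prop5_11_labels_holds :
  Prop5_11_labels Φ R` AS TYPED (v3 of row 106c states the Prop under `Φ.IsStandard`; WITHOUT the standing facts clause (iii) fails on
  degenerate frames — kernel witness `toyDegenerate_labels_clash` in `Prop511L`).
Bullet (3) (`D_{ϑ[k],L_F} ∩ 𝔙 = (L_{𝔙,F})`) needs in addition the unit signs `sgn(s) = ±1` ((v) of `IsStandard` v3); see `Prop511L.proofs.draft.lean`,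
which assembles `Prop5_11_holds : Prop5_11 Φ R` (all eight bullets).
-/

noncomputable section

open MvPolynomial

namespace Literature.AlgebraicGeometry.Hu2025.Statements.S05ThetaBlowups

universe u v

variable {R : Type u} [CommRing R] {V : Type v} [DecidableEq V]

/-! ## One step: coordinate hyperplanes and the unit ideal -/

namespace ChartStep

variable (s : ChartStep V)

/-- `strict(⊤) = ⊤`.
[cite: Hu2025, Prop. 5.11, pp. 86–88 (unrefereed preprint arXiv:2507.21400v1 under adjudication, D-0012/D-0089 — kernel support on OUR typed carrier of row 106; nothing of the source asserted)] -/
theorem strictTransform_top : s.strictTransform (R := R) ⊤ = ⊤ := by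
  unfold strictTransform
  rw [Ideal.map_top]
  refine top_le_iff.mp ?_
  refine le_trans ?_ (le_iSup (fun n : ℕ => (⊤ : Ideal (MvPolynomial V R)).colon ({s.excVar (R := R) ^ n} :
    Set (MvPolynomial V R))) 0)
  intro f _
  rw [Submodule.mem_colon_singleton]
  exact Submodule.mem_top

/-- `strict((ζ')) = ⊤` for the centre coordinate `y'_i` that becomes `ζ` (`π^* y'_i = ζ`, `(ζ : ζ^∞) = (1)`).
[cite: Hu2025, Prop. 5.11, pp. 86–88 (unrefereed preprint arXiv:2507.21400v1 under adjudication, D-0012/D-0089 — kernel support on OUR typed carrier of row 106; nothing of the source asserted)] -/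
theorem strictTransform_span_X_exc : s.strictTransform (R := R) (Ideal.span {X s.exc}) = ⊤ := by
  unfold strictTransform
  rw [Ideal.map_span, Set.image_singleton, pullback_X_exc, excVar_eq]
  refine top_le_iff.mp ?_
  refine le_trans ?_ (le_iSup (fun n : ℕ => (Ideal.span ({X s.exc} : Set (MvPolynomial V R))).colon
    ({X s.exc ^ n} : Set (MvPolynomial V R))) 1)
  intro f _
  rw [Submodule.mem_colon_singleton, smul_eq_mul, pow_one]
  exact Ideal.mul_mem_left _ _ (Ideal.subset_span (Set.mem_singleton _))

/-- One step on a coordinate hyperplane `(x_y)`: unit ideal if `y` is the exceptional index, else `(x_y)`.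
[cite: Hu2025, Prop. 5.11, pp. 86–88 (unrefereed preprint arXiv:2507.21400v1 under adjudication, D-0012/D-0089 — kernel support on OUR typed carrier of row 106; nothing of the source asserted)] -/
theorem strictTransform_span_X_of_ne {y : V} (hy : y ≠ s.exc) :
    s.strictTransform (R := R) (Ideal.span {X y}) = Ideal.span {X y} := by
  by_cases hmem : y ∈ s.centre
  · exact strictTransform_span_X_of_mem s hmem hy
  · exact strictTransform_span_X_of_not_mem s hmem

end ChartStep

/-! ## Words of steps -/

namespace ChartSeq

/-- Along the empty word the strict transform is the identity. [cite: Hu2025, Prop. 5.11, pp. 86–88 (unrefereed preprint arXiv:2507.21400v1 under adjudication, D-0012/D-0089 — kernel support on OUR typed carrier of row 106; nothing of the source asserted)] -/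
theorem strictTransform_nil (I : Ideal (MvPolynomial V R)) : ChartSeq.strictTransform R ([] : ChartSeq V) I = I := rfl

/-- Strict transform along `s :: w`: first the step `s`, then the word `w` (root first). [cite: Hu2025, Prop. 5.11, pp. 86–88 (unrefereed preprint arXiv:2507.21400v1 under adjudication, D-0012/D-0089 — kernel support on OUR typed carrier of row 106; nothing of the source asserted)] -/
theorem strictTransform_cons (s : ChartStep V) (w : ChartSeq V) (I : Ideal (MvPolynomial V R)) :
    ChartSeq.strictTransform R (s :: w) I = ChartSeq.strictTransform R w (s.strictTransform (R := R) I) := rfl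

/-- The strict transform of the unit ideal along any word is the unit ideal. [cite: Hu2025, Prop. 5.11, pp. 86–88 (unrefereed preprint arXiv:2507.21400v1 under adjudication, D-0012/D-0089 — kernel support on OUR typed carrier of row 106; nothing of the source asserted)] -/
theorem strictTransform_top (w : ChartSeq V) : ChartSeq.strictTransform R w (⊤ : Ideal (MvPolynomial V R)) = ⊤ := by
  induction w with
  | nil => rfl
  | cons s w ih => rw [strictTransform_cons, ChartStep.strictTransform_top, ih]

/-- Along a word none of whose steps has `y` as exceptional index, `strict((x_y)) = (x_y)`.
[cite: Hu2025, Prop. 5.11, pp. 86–88 (unrefereed preprint arXiv:2507.21400v1 under adjudication, D-0012/D-0089 — kernel support on OUR typed carrier of row 106; nothing of the source asserted)] -/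
theorem strictTransform_span_X_of_forall_ne (w : ChartSeq V) {y : V} (h : ∀ s ∈ w, y ≠ s.exc) :
    ChartSeq.strictTransform R w (Ideal.span {(X y : MvPolynomial V R)}) = Ideal.span {X y} := by
  induction w with
  | nil => rfl
  | cons s w ih =>
    rw [strictTransform_cons, ChartStep.strictTransform_span_X_of_ne s (h s (by simp)),
      ih fun s' hs' => h s' (by simp [hs'])]

/-- If some step of the word has `y` as exceptional index, `strict((x_y)) = (1)`.
[cite: Hu2025, Prop. 5.11, pp. 86–88 (unrefereed preprint arXiv:2507.21400v1 under adjudication, D-0012/D-0089 — kernel support on OUR typed carrier of row 106; nothing of the source asserted)] -/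
theorem strictTransform_span_X_of_exists_eq (w : ChartSeq V) {y : V} (h : ∃ s ∈ w, y = s.exc) :
    ChartSeq.strictTransform R w (Ideal.span {(X y : MvPolynomial V R)}) = ⊤ := by
  induction w with
  | nil => obtain ⟨s, hs, _⟩ := h; simp at hs
  | cons s w ih =>
    rw [strictTransform_cons]
    by_cases hy : y = s.exc
    · rw [hy, ChartStep.strictTransform_span_X_exc, strictTransform_top]
    · rw [ChartStep.strictTransform_span_X_of_ne s hy]
      obtain ⟨s', hs', hys'⟩ := h
      rcases List.mem_cons.mp hs' with rfl | hs''
      · exact (hy hys').elim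
      · exact ih ⟨s', hs'', hys'⟩

end ChartSeq

/-! ## The word of a chart: membership in `Φ.seq`, `Φ.eSet`, `Φ.dSet` -/

/-- On a ϖ-standard chart the selector `ThetaKind.by` returns its first argument: `ThetaKind.varpi.by a b = a` (by `rfl`).
(Docstring + tag added at filing by the helper res-type-055 — gate lint `lint.docstring`/`lint.tags`; statement and proof = the owner's deposit.)
[cite: Hu2025, Def. 5.15, p.89 (unrefereed preprint arXiv:2507.21400v1 under adjudication, D-0012/D-0089 — definitional unfolding of OUR two-way chart-kind selector `ThetaKind.by` of row 106b (ϖ- or ϱ-standard charts); kernel plumbing for Prop. 5.11's bookkeeping; nothing of the source asserted)] -/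
@[simp] theorem ThetaKind.varpi_by {α : Sort*} (a b : α) : ThetaKind.varpi.by a b = a := rfl
/-- On a ϱ-standard chart the selector `ThetaKind.by` returns its second argument: `ThetaKind.varrho.by a b = b` (by `rfl`).
(Docstring + tag added at filing by the helper res-type-055 — gate lint `lint.docstring`/`lint.tags`; statement and proof = the owner's deposit.)
[cite: Hu2025, Def. 5.15, p.89 (unrefereed preprint arXiv:2507.21400v1 under adjudication, D-0012/D-0089 — definitional unfolding of OUR two-way chart-kind selector `ThetaKind.by` of row 106b (ϖ- or ϱ-standard charts); kernel plumbing for Prop. 5.11's bookkeeping; nothing of the source asserted)] -/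
@[simp] theorem ThetaKind.varrho_by {α : Sort*} (a b : α) : ThetaKind.varrho.by a b = b := rfl

namespace ThetaFrame

variable {P : Type v} {Rs : Type v} [DecidableEq P] [DecidableEq Rs] (Φ : ThetaFrame P Rs)

/-- No ϑ-step on the chart at a block whose leading ϱ-coordinate is the chart's `≡ 1` coordinate («(m,u_k) ∈ Λ^o», Prop. 5.11 proof C37L110–L116). [cite: Hu2025, Prop. 5.11, pp. 86–88 (unrefereed preprint arXiv:2507.21400v1 under adjudication, D-0012/D-0089 — kernel support on OUR typed carrier of row 106; nothing of the source asserted)] -/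
theorem step_of_lead_none {c : Φ.Chart} {j : Fin Φ.N} (h : Φ.lead j = none) : Φ.step c j = none := by
  simp [step, h]

/-- A step present at block `j` comes from a variable leading ϱ-coordinate `r`, and its exceptional index is `u_j` (ϖ) or `(m,u_j)` (ϱ) (Def. 5.15). [cite: Hu2025, Prop. 5.11, pp. 86–88 (unrefereed preprint arXiv:2507.21400v1 under adjudication, D-0012/D-0089 — kernel support on OUR typed carrier of row 106; nothing of the source asserted)] -/
theorem exc_of_step {c : Φ.Chart} {j : Fin Φ.N} {s : ChartStep (P ⊕ Rs)} (hs : Φ.step c j = some s) :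
    ∃ r, Φ.lead j = some r ∧ s.exc = (c j).by (Sum.inl (Φ.ult j)) (Sum.inr r) := by
  cases h : Φ.lead j with
  | none => simp [step, h] at hs
  | some r =>
    refine ⟨r, rfl, ?_⟩
    simp only [step, h, Option.elim_some, Option.some.injEq] at hs
    rw [← hs]

/-- At a block with a variable leading ϱ-coordinate the chart has a ϑ-step, with exceptional index by chart kind (C37L141–L150 / C38L11–L20). [cite: Hu2025, Prop. 5.11, pp. 86–88 (unrefereed preprint arXiv:2507.21400v1 under adjudication, D-0012/D-0089 — kernel support on OUR typed carrier of row 106; nothing of the source asserted)] -/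
theorem step_of_lead_some (c : Φ.Chart) {j : Fin Φ.N} {r : Rs} (h : Φ.lead j = some r) :
    ∃ s, Φ.step c j = some s ∧ s.exc = (c j).by (Sum.inl (Φ.ult j)) (Sum.inr r) := by
  simp only [step, h, Option.elim_some]
  exact ⟨_, rfl, rfl⟩

/-- Membership in the word `Φ.seq c a b`: the steps of the blocks `a ≤ j < b` present on the chart. [cite: Hu2025, Prop. 5.11, pp. 86–88 (unrefereed preprint arXiv:2507.21400v1 under adjudication, D-0012/D-0089 — kernel support on OUR typed carrier of row 106; nothing of the source asserted)] -/
theorem mem_seq {c : Φ.Chart} {a b : ℕ} {s : ChartStep (P ⊕ Rs)} :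
    s ∈ Φ.seq c a b ↔ ∃ j : Fin Φ.N, (a ≤ j.val ∧ j.val < b) ∧ Φ.step c j = some s := by
  simp [seq, List.mem_filterMap, List.mem_filter]

omit [DecidableEq Rs] in
/-- Membership in `𝔢_𝔙` (C37L147 «𝔢_𝔙 = u_k ⊔ 𝔢_𝔙'» on ϖ-charts): the ϖ-indices `u_j` of the ϖ-steps below level `k`. [cite: Hu2025, Prop. 5.11, pp. 86–88 (unrefereed preprint arXiv:2507.21400v1 under adjudication, D-0012/D-0089 — kernel support on OUR typed carrier of row 106; nothing of the source asserted)] -/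
theorem mem_eSet {c : Φ.Chart} {k : ℕ} {w : P} :
    w ∈ Φ.eSet c k ↔ ∃ j : Fin Φ.N, j.val < k ∧ (Φ.lead j).isSome ∧ c j = ThetaKind.varpi ∧ Φ.ult j = w := by
  simp only [eSet, List.mem_toFinset, List.mem_filterMap, List.mem_finRange, true_and]
  refine exists_congr fun j => ?_
  cases hl : Φ.lead j with
  | none => simp
  | some r =>
    cases hc : c j with
    | varpi =>
      by_cases hj : j.val < k <;> simp [hj]
    | varrho => simp

omit [DecidableEq P] in
/-- Membership in `𝔡_𝔙` (C38L17 «𝔡_𝔙 = {(m,u_k)} ⊔ 𝔡_𝔙'» on ϱ-charts): the leading ϱ-indices of the ϱ-steps below level `k`. [cite: Hu2025, Prop. 5.11, pp. 86–88 (unrefereed preprint arXiv:2507.21400v1 under adjudication, D-0012/D-0089 — kernel support on OUR typed carrier of row 106; nothing of the source asserted)] -/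
theorem mem_dSet {c : Φ.Chart} {k : ℕ} {r : Rs} :
    r ∈ Φ.dSet c k ↔ ∃ j : Fin Φ.N, j.val < k ∧ Φ.lead j = some r ∧ c j = ThetaKind.varrho := by
  simp only [dSet, List.mem_toFinset, List.mem_filterMap, List.mem_finRange, true_and]
  refine exists_congr fun j => ?_
  cases hl : Φ.lead j with
  | none => simp
  | some r' =>
    cases hc : c j with
    | varpi => simp
    | varrho =>
      by_cases hj : j.val < k <;> simp [hj]

/-- A step of the word of `c` between levels `a` and `b` has exceptional index `x_w` (`w ∈ 𝕀⋆`) iff it is a ϖ-step at a block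
`j` with `u_j = w`.
[cite: Hu2025, Prop. 5.11, pp. 86–88 (unrefereed preprint arXiv:2507.21400v1 under adjudication, D-0012/D-0089 — kernel support on OUR typed carrier of row 106; nothing of the source asserted)] -/
theorem exists_seq_exc_inl_iff {c : Φ.Chart} {a b : ℕ} {w : P} :
    (∃ s ∈ Φ.seq c a b, (Sum.inl w : P ⊕ Rs) = s.exc) ↔
      ∃ j : Fin Φ.N, (a ≤ j.val ∧ j.val < b) ∧ (Φ.lead j).isSome ∧ c j = ThetaKind.varpi ∧ Φ.ult j = w := by
  constructor
  · rintro ⟨s, hs, hw⟩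
    obtain ⟨j, hj, hstep⟩ := Φ.mem_seq.mp hs
    obtain ⟨r, hr, hexc⟩ := Φ.exc_of_step hstep
    refine ⟨j, hj, by simp [hr], ?_⟩
    cases hc : c j with
    | varpi => rw [hc] at hexc; simp only [ThetaKind.varpi_by] at hexc; exact ⟨rfl, Sum.inl_injective (hexc ▸ hw).symm⟩
    | varrho => rw [hc] at hexc; simp only [ThetaKind.varrho_by] at hexc; rw [hexc] at hw; exact absurd hw Sum.inl_ne_inr
  · rintro ⟨j, hj, hsome, hc, hw⟩
    obtain ⟨r, hr⟩ := Option.isSome_iff_exists.mp hsome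
    obtain ⟨s, hstep, hexc⟩ := Φ.step_of_lead_some c hr
    refine ⟨s, Φ.mem_seq.mpr ⟨j, hj, hstep⟩, ?_⟩
    rw [hexc, hc, ThetaKind.varpi_by, hw]

/-- … has exceptional index `x_{(u,v)}` (`(u,v) = r ∈ Λ⋆`) iff it is a ϱ-step at a block `j` with `(m,u_j) = r`.
[cite: Hu2025, Prop. 5.11, pp. 86–88 (unrefereed preprint arXiv:2507.21400v1 under adjudication, D-0012/D-0089 — kernel support on OUR typed carrier of row 106; nothing of the source asserted)] -/
theorem exists_seq_exc_inr_iff {c : Φ.Chart} {a b : ℕ} {r : Rs} :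
    (∃ s ∈ Φ.seq c a b, (Sum.inr r : P ⊕ Rs) = s.exc) ↔
      ∃ j : Fin Φ.N, (a ≤ j.val ∧ j.val < b) ∧ Φ.lead j = some r ∧ c j = ThetaKind.varrho := by
  constructor
  · rintro ⟨s, hs, hw⟩
    obtain ⟨j, hj, hstep⟩ := Φ.mem_seq.mp hs
    obtain ⟨r', hr, hexc⟩ := Φ.exc_of_step hstep
    refine ⟨j, hj, ?_⟩
    cases hc : c j with
    | varpi => rw [hc] at hexc; simp only [ThetaKind.varpi_by] at hexc; rw [hexc] at hw; exact absurd hw Sum.inr_ne_inl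
    | varrho =>
      rw [hc] at hexc; simp only [ThetaKind.varrho_by] at hexc
      have hrr : r' = r := Sum.inr_injective (hexc.symm.trans hw.symm)
      exact ⟨by rw [hr, hrr], rfl⟩
  · rintro ⟨j, hj, hr, hc⟩
    obtain ⟨s, hstep, hexc⟩ := Φ.step_of_lead_some c hr
    refine ⟨s, Φ.mem_seq.mpr ⟨j, hj, hstep⟩, ?_⟩
    rw [hexc, hc, ThetaKind.varrho_by]

section WithRing

variable (R : Type u) [CommRing R]

/-! ## Prop. 5.11, bullets (1) (2) (4) (5) — unconditionally -/

/-- (1) `X_{ϑ[k],w} ∩ 𝔙 = (x_{𝔙,w})` for `w ∉ 𝔢_𝔙`.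
[cite: Hu2025, Prop. 5.11, pp. 86–88 (unrefereed preprint arXiv:2507.21400v1 under adjudication, D-0012/D-0089 — kernel support on OUR typed carrier of row 106; nothing of the source asserted)] -/
theorem prop5_11_b1 (c : Φ.Chart) (k : ℕ) (w : P) (hw : w ∉ Φ.eSet c k) :
    Φ.plDivAt R c k w = Ideal.span {X (Sum.inl w)} := by
  unfold plDivAt
  refine ChartSeq.strictTransform_span_X_of_forall_ne _ fun s hs heq => hw ?_
  obtain ⟨j, hj, hsome, hc, hu⟩ := Φ.exists_seq_exc_inl_iff.mp ⟨s, hs, heq⟩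
  exact Φ.mem_eSet.mpr ⟨j, hj.2, hsome, hc, hu⟩

/-- (2) `X_{ϑ[k],(u,v)} ∩ 𝔙 = (x_{𝔙,(u,v)})` for `(u,v) ∉ 𝔡_𝔙`.
[cite: Hu2025, Prop. 5.11, pp. 86–88 (unrefereed preprint arXiv:2507.21400v1 under adjudication, D-0012/D-0089 — kernel support on OUR typed carrier of row 106; nothing of the source asserted)] -/
theorem prop5_11_b2 (c : Φ.Chart) (k : ℕ) (r : Rs) (hr : r ∉ Φ.dSet c k) :
    Φ.rhoDivAt R c k r = Ideal.span {X (Sum.inr r)} := by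
  unfold rhoDivAt
  refine ChartSeq.strictTransform_span_X_of_forall_ne _ fun s hs heq => hr ?_
  obtain ⟨j, hj, hlead, hc⟩ := Φ.exists_seq_exc_inr_iff.mp ⟨s, hs, heq⟩
  exact Φ.mem_dSet.mpr ⟨j, hj.2, hlead, hc⟩

/-- (4) `X_{ϑ[k],w}` misses the chart for `w ∈ 𝔢_𝔙`.
[cite: Hu2025, Prop. 5.11, pp. 86–88 (unrefereed preprint arXiv:2507.21400v1 under adjudication, D-0012/D-0089 — kernel support on OUR typed carrier of row 106; nothing of the source asserted)] -/
theorem prop5_11_b4 (c : Φ.Chart) (k : ℕ) (w : P) (hw : w ∈ Φ.eSet c k) : Φ.plDivAt R c k w = ⊤ := by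
  unfold plDivAt
  obtain ⟨j, hj, hsome, hc, hu⟩ := Φ.mem_eSet.mp hw
  exact ChartSeq.strictTransform_span_X_of_exists_eq _
    (Φ.exists_seq_exc_inl_iff.mpr ⟨j, ⟨Nat.zero_le _, hj⟩, hsome, hc, hu⟩)

/-- (5) `X_{ϑ[k],(u,v)}` misses the chart for `(u,v) ∈ 𝔡_𝔙`.
[cite: Hu2025, Prop. 5.11, pp. 86–88 (unrefereed preprint arXiv:2507.21400v1 under adjudication, D-0012/D-0089 — kernel support on OUR typed carrier of row 106; nothing of the source asserted)] -/
theorem prop5_11_b5 (c : Φ.Chart) (k : ℕ) (r : Rs) (hr : r ∈ Φ.dSet c k) : Φ.rhoDivAt R c k r = ⊤ := by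
  unfold rhoDivAt
  obtain ⟨j, hj, hlead, hc⟩ := Φ.mem_dSet.mp hr
  exact ChartSeq.strictTransform_span_X_of_exists_eq _
    (Φ.exists_seq_exc_inr_iff.mpr ⟨j, ⟨Nat.zero_le _, hj⟩, hlead, hc⟩)

/-! ## Prop. 5.11, bullet (8) and the labels — (8), (i), (ii), (iv) unconditionally; (iii), (6), (7) under the standing facts -/

/-- (8) unlabelled exceptional divisors have the unit ideal on the chart.
[cite: Hu2025, Prop. 5.11, pp. 86–88 (unrefereed preprint arXiv:2507.21400v1 under adjudication, D-0012/D-0089 — kernel support on OUR typed carrier of row 106; nothing of the source asserted)] -/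
theorem prop5_11_b8 (c : Φ.Chart) (k : ℕ) (j : Fin Φ.N) (h : Φ.labAt c k j = none) : Φ.excDivAt R c k j = ⊤ := by
  unfold labAt at h
  unfold excDivAt
  by_cases hj : j.val < k
  · rw [if_pos hj] at h ⊢
    cases hl : Φ.lead j with
    | none => rfl
    | some r => simp [hl] at h
  · rw [if_neg hj]

omit [DecidableEq P] [DecidableEq Rs] in
/-- The label of the `j`-th exceptional divisor on the chart (Prop. 5.11 C37L37–L45): present iff the step is performed below level `k`, and then `u_j` or `(m,u_j)` by chart kind. [cite: Hu2025, Prop. 5.11, pp. 86–88 (unrefereed preprint arXiv:2507.21400v1 under adjudication, D-0012/D-0089 — kernel support on OUR typed carrier of row 106; nothing of the source asserted)] -/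
theorem labAt_eq_some_iff {c : Φ.Chart} {k : ℕ} {j : Fin Φ.N} {l : P ⊕ Rs} :
    Φ.labAt c k j = some l ↔ j.val < k ∧ ∃ r, Φ.lead j = some r ∧ l = (c j).by (Sum.inl (Φ.ult j)) (Sum.inr r) := by
  unfold labAt
  by_cases hj : j.val < k
  · rw [if_pos hj]
    cases hl : Φ.lead j with
    | none => simp [hj]
    | some r => simp [hj, eq_comm]
  · rw [if_neg hj]; simp [hj]

/-- The chart ideal of `E_{ϑ[k],j}` for a performed step: the strict transform of its exceptional hyperplane along the later steps (C36L142–L147). [cite: Hu2025, Prop. 5.11, pp. 86–88 (unrefereed preprint arXiv:2507.21400v1 under adjudication, D-0012/D-0089 — kernel support on OUR typed carrier of row 106; nothing of the source asserted)] -/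
theorem excDivAt_of_lead_some {c : Φ.Chart} {k : ℕ} {j : Fin Φ.N} (hj : j.val < k) {r : Rs} (hl : Φ.lead j = some r) :
    Φ.excDivAt R c k j =
      ChartSeq.strictTransform R (Φ.seq c (j + 1) k)
        (Ideal.span {(c j).by (epsVar R (Φ.ult j)) (deltaVar R r)}) := by
  unfold excDivAt
  rw [if_pos hj, hl]
  rfl

/-- labels (i): an exceptional divisor meeting the chart carries a label.
[cite: Hu2025, Prop. 5.11, pp. 86–88 (unrefereed preprint arXiv:2507.21400v1 under adjudication, D-0012/D-0089 — kernel support on OUR typed carrier of row 106; nothing of the source asserted)] -/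
theorem prop5_11_labels_i (c : Φ.Chart) (k : ℕ) (j : Fin Φ.N) (h : Φ.excDivAt R c k j ≠ ⊤) : (Φ.labAt c k j).isSome := by
  cases hlab : Φ.labAt c k j with
  | some _ => rfl
  | none => exact (h (Φ.prop5_11_b8 R c k j hlab)).elim

/-- labels (ii): labels lie in `𝔢_𝔙 ⊔ 𝔡_𝔙`.
[cite: Hu2025, Prop. 5.11, pp. 86–88 (unrefereed preprint arXiv:2507.21400v1 under adjudication, D-0012/D-0089 — kernel support on OUR typed carrier of row 106; nothing of the source asserted)] -/
theorem prop5_11_labels_ii (c : Φ.Chart) (k : ℕ) (j : Fin Φ.N) (l : P ⊕ Rs) (h : Φ.labAt c k j = some l) :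
    Sum.elim (fun w => w ∈ Φ.eSet c k) (fun r => r ∈ Φ.dSet c k) l := by
  obtain ⟨hj, r, hl, rfl⟩ := Φ.labAt_eq_some_iff.mp h
  cases hc : c j with
  | varpi => simp only [ThetaKind.varpi_by, Sum.elim_inl]; exact Φ.mem_eSet.mpr ⟨j, hj, by simp [hl], hc, rfl⟩
  | varrho => simp only [ThetaKind.varrho_by, Sum.elim_inr]; exact Φ.mem_dSet.mpr ⟨j, hj, hl, hc⟩

/-- labels (iv): every element of `𝔢_𝔙 ⊔ 𝔡_𝔙` labels some exceptional divisor.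
[cite: Hu2025, Prop. 5.11, pp. 86–88 (unrefereed preprint arXiv:2507.21400v1 under adjudication, D-0012/D-0089 — kernel support on OUR typed carrier of row 106; nothing of the source asserted)] -/
theorem prop5_11_labels_iv (c : Φ.Chart) (k : ℕ) (l : P ⊕ Rs)
    (h : Sum.elim (fun w => w ∈ Φ.eSet c k) (fun r => r ∈ Φ.dSet c k) l) : ∃ j, Φ.labAt c k j = some l := by
  cases l with
  | inl w =>
    obtain ⟨j, hj, hsome, hc, hu⟩ := Φ.mem_eSet.mp h
    obtain ⟨r, hr⟩ := Option.isSome_iff_exists.mp hsome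
    exact ⟨j, Φ.labAt_eq_some_iff.mpr ⟨hj, r, hr, by rw [hc, ThetaKind.varpi_by, hu]⟩⟩
  | inr r =>
    obtain ⟨j, hj, hlead, hc⟩ := Φ.mem_dSet.mp h
    exact ⟨j, Φ.labAt_eq_some_iff.mpr ⟨hj, r, hlead, by rw [hc, ThetaKind.varrho_by]⟩⟩

omit [DecidableEq P] [DecidableEq Rs] in
/-- labels (iii): distinct exceptional divisors carry distinct labels — under `u_k` distinct and the block map.
[cite: Hu2025, Prop. 5.11, pp. 86–88 (unrefereed preprint arXiv:2507.21400v1 under adjudication, D-0012/D-0089 — kernel support on OUR typed carrier of row 106; nothing of the source asserted)] -/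
theorem prop5_11_labels_iii (hult : Function.Injective Φ.ult) (hblk : ∀ k r, Φ.lead k = some r → Φ.blk r = k)
    (c : Φ.Chart) (k : ℕ) (j₁ j₂ : Fin Φ.N) (l : P ⊕ Rs)
    (h₁ : Φ.labAt c k j₁ = some l) (h₂ : Φ.labAt c k j₂ = some l) : j₁ = j₂ := by
  obtain ⟨-, r₁, hl₁, rfl⟩ := Φ.labAt_eq_some_iff.mp h₁
  obtain ⟨-, r₂, hl₂, h⟩ := Φ.labAt_eq_some_iff.mp h₂
  cases hc₁ : c j₁ with
  | varpi =>
    cases hc₂ : c j₂ with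
    | varpi => rw [hc₁, hc₂] at h; simp only [ThetaKind.varpi_by, Sum.inl.injEq] at h; exact hult h
    | varrho => rw [hc₁, hc₂] at h; simp at h
  | varrho =>
    cases hc₂ : c j₂ with
    | varpi => rw [hc₁, hc₂] at h; simp at h
    | varrho =>
      rw [hc₁, hc₂] at h; simp only [ThetaKind.varrho_by, Sum.inr.injEq] at h
      rw [← hblk j₁ r₁ hl₁, ← hblk j₂ r₂ hl₂, h]

/-- (6) `E_{ϑ[k],w} ∩ 𝔙 = (ε_{𝔙,w})` for the exceptional divisor labelled `w ∈ 𝔢_𝔙` — under `u_k` distinct.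
[cite: Hu2025, Prop. 5.11, pp. 86–88 (unrefereed preprint arXiv:2507.21400v1 under adjudication, D-0012/D-0089 — kernel support on OUR typed carrier of row 106; nothing of the source asserted)] -/
theorem prop5_11_b6 (hult : Function.Injective Φ.ult) (c : Φ.Chart) (k : ℕ) (j : Fin Φ.N) (w : P)
    (h : Φ.labAt c k j = some (Sum.inl w)) : Φ.excDivAt R c k j = Ideal.span {epsVar R w} := by
  obtain ⟨hj, r, hl, hw⟩ := Φ.labAt_eq_some_iff.mp h
  cases hc : c j with
  | varrho => rw [hc] at hw; simp at hw
  | varpi =>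
    rw [hc, ThetaKind.varpi_by, Sum.inl.injEq] at hw
    rw [Φ.excDivAt_of_lead_some R hj hl, hc, ThetaKind.varpi_by, hw]
    unfold epsVar
    refine ChartSeq.strictTransform_span_X_of_forall_ne _ fun s hs heq => ?_
    obtain ⟨j', hj', -, -, hu⟩ := Φ.exists_seq_exc_inl_iff.mp ⟨s, hs, heq⟩
    have hjj : j' = j := hult hu
    exact absurd (congrArg Fin.val hjj) (by omega)

/-- (7) `E_{ϑ[k],(u,v)} ∩ 𝔙 = (δ_{𝔙,(u,v)})` for the exceptional divisor labelled `(u,v) ∈ 𝔡_𝔙` — under the block map.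
[cite: Hu2025, Prop. 5.11, pp. 86–88 (unrefereed preprint arXiv:2507.21400v1 under adjudication, D-0012/D-0089 — kernel support on OUR typed carrier of row 106; nothing of the source asserted)] -/
theorem prop5_11_b7 (hblk : ∀ k r, Φ.lead k = some r → Φ.blk r = k) (c : Φ.Chart) (k : ℕ) (j : Fin Φ.N) (r : Rs)
    (h : Φ.labAt c k j = some (Sum.inr r)) : Φ.excDivAt R c k j = Ideal.span {deltaVar R r} := by
  obtain ⟨hj, r', hl, hw⟩ := Φ.labAt_eq_some_iff.mp h
  cases hc : c j with
  | varpi => rw [hc] at hw; simp at hw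
  | varrho =>
    rw [hc, ThetaKind.varrho_by, Sum.inr.injEq] at hw
    rw [Φ.excDivAt_of_lead_some R hj hl, hc, ThetaKind.varrho_by, ← hw]
    unfold deltaVar
    refine ChartSeq.strictTransform_span_X_of_forall_ne _ fun s hs heq => ?_
    obtain ⟨j', hj', hlead', -⟩ := Φ.exists_seq_exc_inr_iff.mp ⟨s, hs, heq⟩
    have h1 := hblk j' r hlead'
    have h2 := hblk j r' hl
    rw [hw] at h1
    have hjj : j' = j := h1.symm.trans h2
    exact absurd (congrArg Fin.val hjj) (by omega)

/-- **The «unique label» paragraph of Prop. 5.11 (`Prop5_11_labels`, v3: stated under `Φ.IsStandard`) holds AS TYPED on every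
frame** — of the standing facts only `u_k` distinct (i) and the block map (iv) are used.
[cite: Hu2025, Prop. 5.11, pp. 86–88 (unrefereed preprint arXiv:2507.21400v1 under adjudication, D-0012/D-0089 — kernel support on OUR typed carrier of row 106; nothing of the source asserted)] -/
theorem Prop5_11_labels_holds : Prop5_11_labels Φ R := fun hstd c k _ =>
  ⟨fun j h => Φ.prop5_11_labels_i R c k j h, fun j l h => Φ.prop5_11_labels_ii c k j l h,
    fun j₁ j₂ l h₁ h₂ => Φ.prop5_11_labels_iii hstd.1 hstd.2.2.2.1 c k j₁ j₂ l h₁ h₂, fun l h => Φ.prop5_11_labels_iv c k l h⟩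

end WithRing

end ThetaFrame

end Literature.AlgebraicGeometry.Hu2025.Statements.S05ThetaBlowups

end
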